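import Summits.ABC.IUTFork.Joshi.DictionaryHarnessBridge
import HarnessLib

/-!
# Branch E, X-07″: HULL OR VOLUME — under the indeterminacy dichotomy, S never does work that volume transport does not
# (adversary seat abc-iut-E-cx)

AUTHORED BY abc-iut-E-cx (refuter seat refuter-abc-iut-E-cx-g0-0); proxy-filed VERBATIM by a prover hand per the cell's PROXY RULE
(plan/repair/REPAIR-SPEC.md §2). Record file of the abc-iut cell, branch E «type Joshi's construction, test vs S» (rung LADDER-ABC:A2.E;
E-PLAN R16 (c), X-07′/X-07″). **No side is taken** on [IUTchIII] Cor. 3.12, on Joshi's claims (unrefereed arXiv preprints) or on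
Mochizuki's report on them; typed ≠ proved ≠ endorsed. PROOF-ONLY over `Joshi/DictionaryHarnessBridge.lean` (p429682) and
`Joshi/TestHarness.lean` (p428758): 0 new `def`, no `Prop` fact, no instance, no `sorry`.

## Content (generic over the lattice binders `(S, P, ρ, qK)` of S)
S := `Cor312Vol.PilotKummerIndRelated S P ρ qK`. The INDETERMINACY DICHOTOMY at a packet `(i+1, v_ℚ)` is the HYPOTHESIS (binder `H1`,
never asserted) that every element `Φ` of `⟨(Ind1) ∪ (Ind2)⟩` is, at that packet, EITHER volume-preserving on admissible regions
(`Adm A → Adm (Φ '' A) ∧ logvol (Φ '' A) = logvol A` — isometries; [IUTchIV] Thm 1.10 Step (v)) OR hull-destroying (for every hull-set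
`λ·𝒪` some power `Φ^k` carries the (Ind3)-enlarged Θ-region out of it — valuation-rescalings, `Joshi.not_hullDefined_of_gaugeShift`).
On honest ℚ_p-linear carriers with ball frames every `Φ` is one or the other (|det Φ|_p = 1, or an eigen-direction is rescaled);
E-t41's `TestIsmDichotomy` discharges `H1` for the cell's ℚ-line carriers. Nothing here asserts `H1`.
* `volumeTransportAt_or_not_hullDefined_of_indCoversQ`: under the two pins, admissible datum-regions, `LogvolMono` and `H1`, the
  containment form of S's region clause (`IndCoversQ`, p428758) gives AT EACH PACKET: volume transport there
  (`∃ m, qLocal ≤ logvol (thetaRegion m)`) OR `¬HullDefined` there.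
* `volumeTransport_of_indCoversQ_of_hullDefined`, `volumeTransport_of_pilotKummerIndRelated` (+ `BridgeHyps`, Thm 3.11 (ii)(b)):
  **S ∧ BridgeHyps ⟹ VT** under `H1` — so wherever the S-route `statement_of_pilotKummerCompat (H : BridgeHyps P)` applies, the
  S-free route `Cor312Vol.statement_of_volumeTransport` already applies (`statement_of_pilotKummerIndRelated_via_volume`).
* `not_hullDefined_of_indCoversQ_of_thetaBelow`: at a packet where EVERY Θ-Kummer region is strictly smaller in log-volume than the
  q-region (the cell's object-honest situation: `q̲^{j²}` vs `q̲`, `Joshi.thetaBelowQ_pinnedSetting`), S forces `¬HullDefined`, hence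
  (`not_statement_of_indCoversQ_of_thetaBelow`) the printed Statement and the bridge hypotheses FAIL AS TYPED.
LOCATED SENTENCE (tree currency, no side taken): in OUR typed framework — Θ-hull := hull of the full `⟨Ind1 ∪ Ind2⟩`-orbit — and
under the dichotomy, the licence S can hold at an honest-volume packet with Θ below q ONLY where `^{n,∘}𝒰` is undefined; where the
hulls are defined, S yields nothing beyond volume transport. This is the X-06 / X-07′ TRICHOTOMY (E-plan 06:50:08Z) as one theorem
schema. [claim: Mochizuki2012, status: disputed] [claim: Joshi2024ATS3, status: disputed]. Standard axioms only; no `sorry`.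
-/

noncomputable section

open Set

namespace Summit.ABC.IUTFork.Joshi

open Thm311 Cor312 Cor312Vol

variable {T : ThetaIndex} {S : LatticeSituation T} {P : Cor312.Setting S.toSituation}
  {ρ : (∀ v : T.V, v ∈ T.Vbad → Set (S.L.StarPacket v)) → ∀ (j : T.Label) (vQ : T.VQ), Set (S.L.Packet j vQ)}
  {qK : ∀ v : T.V, v ∈ T.Vbad → Set (S.L.StarPacket v)}

/-- **Packetwise: volume transport or hull blow-up.** Under the two pins, admissible datum-regions, `LogvolMono` and the
indeterminacy dichotomy `H1` at `(i+1, v_ℚ)`, `IndCoversQ` gives volume transport at that packet or `¬HullDefined` there. [folklore] -/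
theorem volumeTransportAt_or_not_hullDefined_of_indCoversQ (hmono : LogvolMono P) (hpin : PinnedRegions S P ρ qK)
    {i : Fin T.lstar} {vQ : T.VQ}
    (hq : (S.D P.n).Adm (Setting.labelSucc i) vQ (ρ qK (Setting.labelSucc i) vQ))
    (hΘ : ∀ m : ℤ, (S.D P.n).Adm (Setting.labelSucc i) vQ (ρ ((S.col P.n).frobΨ m) (Setting.labelSucc i) vQ))
    (H1 : ∀ Φ ∈ Subgroup.closure (S.L.Ind1Family ∪ S.L.Ind2Family),
      (∀ A : Set (S.L.Packet (Setting.labelSucc i) vQ), (S.D P.n).Adm _ vQ A →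
          (S.D P.n).Adm _ vQ (Φ _ vQ '' A) ∧ (S.D P.n).logvol _ vQ (Φ _ vQ '' A) = (S.D P.n).logvol _ vQ A) ∨
      (∀ H ∈ (P.frame (Setting.labelSucc i) vQ).Hul, ∃ k : ℕ,
          ¬ (Φ ^ k) (Setting.labelSucc i) vQ '' P.thetaRegion3 (Setting.labelSucc i) vQ ⊆ H))
    (h : IndCoversQ S P ρ qK) :
    (∃ m : ℤ, P.qLocal (Setting.labelSucc i) vQ ≤
        (S.D P.n).logvol (Setting.labelSucc i) vQ (P.thetaRegion m (Setting.labelSucc i) vQ)) ∨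
      ¬ P.HullDefined (Setting.labelSucc i) vQ := by
  obtain ⟨Φ, hΦ, m, hm⟩ := h (Setting.labelSucc i) vQ
  rcases H1 Φ hΦ with hv | hd
  · refine Or.inl ⟨m, ?_⟩
    unfold Setting.qLocal
    rw [hpin.2 _ vQ, hpin.1.2 m _ vQ, ← (hv _ (hΘ m)).2]
    exact hmono i vQ hq (hv _ (hΘ m)).1 hm
  · refine Or.inr (not_hullDefined_of_escapes fun H hH => ?_)
    obtain ⟨k, hk⟩ := hd H hH
    exact ⟨_, ⟨Φ ^ k, (Setting.indGroup S.toSituation).pow_mem hΦ k, rfl⟩, hk⟩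

/-- **S's region clause + defined hulls ⟹ volume transport** (under the dichotomy at every packet). [folklore] -/
theorem volumeTransport_of_indCoversQ_of_hullDefined (hmono : LogvolMono P) (hpin : PinnedRegions S P ρ qK)
    (hq : ∀ (i : Fin T.lstar) (vQ : T.VQ), (S.D P.n).Adm (Setting.labelSucc i) vQ (ρ qK (Setting.labelSucc i) vQ))
    (hΘ : ∀ (m : ℤ) (i : Fin T.lstar) (vQ : T.VQ),
      (S.D P.n).Adm (Setting.labelSucc i) vQ (ρ ((S.col P.n).frobΨ m) (Setting.labelSucc i) vQ))
    (H1 : ∀ Φ ∈ Subgroup.closure (S.L.Ind1Family ∪ S.L.Ind2Family), ∀ (i : Fin T.lstar) (vQ : T.VQ),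
      (∀ A : Set (S.L.Packet (Setting.labelSucc i) vQ), (S.D P.n).Adm _ vQ A →
          (S.D P.n).Adm _ vQ (Φ _ vQ '' A) ∧ (S.D P.n).logvol _ vQ (Φ _ vQ '' A) = (S.D P.n).logvol _ vQ A) ∨
      (∀ H ∈ (P.frame (Setting.labelSucc i) vQ).Hul, ∃ k : ℕ,
          ¬ (Φ ^ k) (Setting.labelSucc i) vQ '' P.thetaRegion3 (Setting.labelSucc i) vQ ⊆ H))
    (hdef : ∀ (i : Fin T.lstar) (vQ : T.VQ), P.HullDefined (Setting.labelSucc i) vQ) (h : IndCoversQ S P ρ qK) :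
    VolumeTransport P := fun i vQ =>
  (volumeTransportAt_or_not_hullDefined_of_indCoversQ hmono hpin (hq i vQ) (fun m => hΘ m i vQ)
    (fun Φ hΦ => H1 Φ hΦ i vQ) h).resolve_right (not_not.2 (hdef i vQ))

/-- **S ∧ BridgeHyps ⟹ VT** under the dictionary-free hypotheses above (Thm 3.11 (ii)(b) for column `n` turns S into `IndCoversQ`;
`BridgeHyps` supplies `HullDefined` at every label in `𝔽_l^⋇`). [claim: Mochizuki2012, status: disputed] -/
theorem volumeTransport_of_pilotKummerIndRelated (H : BridgeHyps P) (hKumB : (S.col P.n).KummerB (S.D P.n))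
    (hmono : LogvolMono P) (hpin : PinnedRegions S P ρ qK)
    (hq : ∀ (i : Fin T.lstar) (vQ : T.VQ), (S.D P.n).Adm (Setting.labelSucc i) vQ (ρ qK (Setting.labelSucc i) vQ))
    (hΘ : ∀ (m : ℤ) (i : Fin T.lstar) (vQ : T.VQ),
      (S.D P.n).Adm (Setting.labelSucc i) vQ (ρ ((S.col P.n).frobΨ m) (Setting.labelSucc i) vQ))
    (H1 : ∀ Φ ∈ Subgroup.closure (S.L.Ind1Family ∪ S.L.Ind2Family), ∀ (i : Fin T.lstar) (vQ : T.VQ),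
      (∀ A : Set (S.L.Packet (Setting.labelSucc i) vQ), (S.D P.n).Adm _ vQ A →
          (S.D P.n).Adm _ vQ (Φ _ vQ '' A) ∧ (S.D P.n).logvol _ vQ (Φ _ vQ '' A) = (S.D P.n).logvol _ vQ A) ∨
      (∀ H ∈ (P.frame (Setting.labelSucc i) vQ).Hul, ∃ k : ℕ,
          ¬ (Φ ^ k) (Setting.labelSucc i) vQ '' P.thetaRegion3 (Setting.labelSucc i) vQ ⊆ H))
    (hS : PilotKummerIndRelated S P ρ qK) : VolumeTransport P :=
  volumeTransport_of_indCoversQ_of_hullDefined hmono hpin hq hΘ H1 (fun i vQ => hullDefined_of_finite H i vQ)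
    (indCoversQ_of_pilotKummerIndRelated hKumB hpin.1.1 hS)

/-- **… so the S-route to the Statement factors through the S-free volume route** (`statement_of_subsetVolumeBound` ∘
`subsetVolumeBound_of_volumeTransport`): wherever `statement_of_pilotKummerCompat (H : BridgeHyps P)` applies under the dichotomy,
volume transport already gives the Statement. [claim: Mochizuki2012, status: disputed] -/
theorem statement_of_pilotKummerIndRelated_via_volume (H : BridgeHyps P) (hKumB : (S.col P.n).KummerB (S.D P.n))
    (hmono : LogvolMono P) (hpin : PinnedRegions S P ρ qK) (hadm : ThetaRegionsAdm P)
    (hq : ∀ (i : Fin T.lstar) (vQ : T.VQ), (S.D P.n).Adm (Setting.labelSucc i) vQ (ρ qK (Setting.labelSucc i) vQ))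
    (hΘ : ∀ (m : ℤ) (i : Fin T.lstar) (vQ : T.VQ),
      (S.D P.n).Adm (Setting.labelSucc i) vQ (ρ ((S.col P.n).frobΨ m) (Setting.labelSucc i) vQ))
    (H1 : ∀ Φ ∈ Subgroup.closure (S.L.Ind1Family ∪ S.L.Ind2Family), ∀ (i : Fin T.lstar) (vQ : T.VQ),
      (∀ A : Set (S.L.Packet (Setting.labelSucc i) vQ), (S.D P.n).Adm _ vQ A →
          (S.D P.n).Adm _ vQ (Φ _ vQ '' A) ∧ (S.D P.n).logvol _ vQ (Φ _ vQ '' A) = (S.D P.n).logvol _ vQ A) ∨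
      (∀ H ∈ (P.frame (Setting.labelSucc i) vQ).Hul, ∃ k : ℕ,
          ¬ (Φ ^ k) (Setting.labelSucc i) vQ '' P.thetaRegion3 (Setting.labelSucc i) vQ ⊆ H))
    (hS : PilotKummerIndRelated S P ρ qK) :
    VolumeTransport P ∧ P.Statement :=
  have hVT := volumeTransport_of_pilotKummerIndRelated H hKumB hmono hpin hq hΘ H1 hS
  ⟨hVT, statement_of_subsetVolumeBound H (subsetVolumeBound_of_volumeTransport hadm hVT)⟩

/-- **Θ below q + S ⟹ hull blow-up.** At a packet where every Θ-Kummer datum-region is admissible and STRICTLY smaller in log-volume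
than the (admissible) q-datum region — the object-honest situation `q̲^{j²}` vs `q̲` — `IndCoversQ` (hence S under Thm 3.11 (ii)(b)) is
incompatible with volume preservation (X-06), so under the dichotomy the witnessing indeterminacy destroys the hull there. [folklore] -/
theorem not_hullDefined_of_indCoversQ_of_thetaBelow (hmono : LogvolMono P) (hpin : PinnedRegions S P ρ qK)
    {i : Fin T.lstar} {vQ : T.VQ}
    (hq : (S.D P.n).Adm (Setting.labelSucc i) vQ (ρ qK (Setting.labelSucc i) vQ))
    (hΘ : ∀ m : ℤ, (S.D P.n).Adm (Setting.labelSucc i) vQ (ρ ((S.col P.n).frobΨ m) (Setting.labelSucc i) vQ))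
    (hlt : ∀ m : ℤ, (S.D P.n).logvol (Setting.labelSucc i) vQ (ρ ((S.col P.n).frobΨ m) (Setting.labelSucc i) vQ) <
      (S.D P.n).logvol (Setting.labelSucc i) vQ (ρ qK (Setting.labelSucc i) vQ))
    (H1 : ∀ Φ ∈ Subgroup.closure (S.L.Ind1Family ∪ S.L.Ind2Family),
      (∀ A : Set (S.L.Packet (Setting.labelSucc i) vQ), (S.D P.n).Adm _ vQ A →
          (S.D P.n).Adm _ vQ (Φ _ vQ '' A) ∧ (S.D P.n).logvol _ vQ (Φ _ vQ '' A) = (S.D P.n).logvol _ vQ A) ∨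
      (∀ H ∈ (P.frame (Setting.labelSucc i) vQ).Hul, ∃ k : ℕ,
          ¬ (Φ ^ k) (Setting.labelSucc i) vQ '' P.thetaRegion3 (Setting.labelSucc i) vQ ⊆ H))
    (h : IndCoversQ S P ρ qK) : ¬ P.HullDefined (Setting.labelSucc i) vQ := by
  rcases volumeTransportAt_or_not_hullDefined_of_indCoversQ hmono hpin hq hΘ H1 h with ⟨m, hm⟩ | hnd
  · exfalso
    unfold Setting.qLocal at hm
    rw [hpin.2 _ vQ, hpin.1.2 m _ vQ] at hm
    exact (lt_irrefl _) ((hlt m).trans_le hm)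
  · exact hnd

/-- **… hence the printed Statement and the bridge hypotheses FAIL AS TYPED there** (`−|log(Θ)| = ⊤`): the TRICHOTOMY as one schema —
at an honest-volume packet with Θ below q, S can hold only where `^{n,∘}𝒰` is undefined. [claim: Mochizuki2012, status: disputed] -/
theorem not_statement_of_indCoversQ_of_thetaBelow (hmono : LogvolMono P) (hpin : PinnedRegions S P ρ qK)
    {i : Fin T.lstar} {vQ : T.VQ}
    (hq : (S.D P.n).Adm (Setting.labelSucc i) vQ (ρ qK (Setting.labelSucc i) vQ))
    (hΘ : ∀ m : ℤ, (S.D P.n).Adm (Setting.labelSucc i) vQ (ρ ((S.col P.n).frobΨ m) (Setting.labelSucc i) vQ))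
    (hlt : ∀ m : ℤ, (S.D P.n).logvol (Setting.labelSucc i) vQ (ρ ((S.col P.n).frobΨ m) (Setting.labelSucc i) vQ) <
      (S.D P.n).logvol (Setting.labelSucc i) vQ (ρ qK (Setting.labelSucc i) vQ))
    (H1 : ∀ Φ ∈ Subgroup.closure (S.L.Ind1Family ∪ S.L.Ind2Family),
      (∀ A : Set (S.L.Packet (Setting.labelSucc i) vQ), (S.D P.n).Adm _ vQ A →
          (S.D P.n).Adm _ vQ (Φ _ vQ '' A) ∧ (S.D P.n).logvol _ vQ (Φ _ vQ '' A) = (S.D P.n).logvol _ vQ A) ∨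
      (∀ H ∈ (P.frame (Setting.labelSucc i) vQ).Hul, ∃ k : ℕ,
          ¬ (Φ ^ k) (Setting.labelSucc i) vQ '' P.thetaRegion3 (Setting.labelSucc i) vQ ⊆ H))
    (h : IndCoversQ S P ρ qK) : ¬ P.Statement ∧ ¬ BridgeHyps P :=
  ⟨not_statement_of_not_hullDefined (not_hullDefined_of_indCoversQ_of_thetaBelow hmono hpin hq hΘ hlt H1 h),
    not_bridgeHyps_of_not_hullDefined (not_hullDefined_of_indCoversQ_of_thetaBelow hmono hpin hq hΘ hlt H1 h)⟩

/-- **S-form of the blow-up** (Thm 3.11 (ii)(b) for column `n` supplies `IndCoversQ` from S). [claim: Mochizuki2012, status: disputed] -/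
theorem not_statement_of_pilotKummerIndRelated_of_thetaBelow (hKumB : (S.col P.n).KummerB (S.D P.n))
    (hmono : LogvolMono P) (hpin : PinnedRegions S P ρ qK) {i : Fin T.lstar} {vQ : T.VQ}
    (hq : (S.D P.n).Adm (Setting.labelSucc i) vQ (ρ qK (Setting.labelSucc i) vQ))
    (hΘ : ∀ m : ℤ, (S.D P.n).Adm (Setting.labelSucc i) vQ (ρ ((S.col P.n).frobΨ m) (Setting.labelSucc i) vQ))
    (hlt : ∀ m : ℤ, (S.D P.n).logvol (Setting.labelSucc i) vQ (ρ ((S.col P.n).frobΨ m) (Setting.labelSucc i) vQ) <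
      (S.D P.n).logvol (Setting.labelSucc i) vQ (ρ qK (Setting.labelSucc i) vQ))
    (H1 : ∀ Φ ∈ Subgroup.closure (S.L.Ind1Family ∪ S.L.Ind2Family),
      (∀ A : Set (S.L.Packet (Setting.labelSucc i) vQ), (S.D P.n).Adm _ vQ A →
          (S.D P.n).Adm _ vQ (Φ _ vQ '' A) ∧ (S.D P.n).logvol _ vQ (Φ _ vQ '' A) = (S.D P.n).logvol _ vQ A) ∨
      (∀ H ∈ (P.frame (Setting.labelSucc i) vQ).Hul, ∃ k : ℕ,
          ¬ (Φ ^ k) (Setting.labelSucc i) vQ '' P.thetaRegion3 (Setting.labelSucc i) vQ ⊆ H))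
    (hS : PilotKummerIndRelated S P ρ qK) : ¬ P.Statement ∧ ¬ BridgeHyps P :=
  not_statement_of_indCoversQ_of_thetaBelow hmono hpin hq hΘ hlt H1
    (indCoversQ_of_pilotKummerIndRelated hKumB hpin.1.1 hS)

end Summit.ABC.IUTFork.Joshi

end
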